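import Summits.NavierStokesRegularity.NavierStokesRegularity.Theorems.AxisTwistDoorAveragedConeLiouvilleNULipDefs
import HarnessLib

/-!
# Nazarov–Uraltseva 2011 §3 for WEAK LIPSCHITZ DATA — the two N-W texts `Sig.nu_weakEnergyIdentity`
# (W1) and `Sig.nu_standing_of_weak` (W) (texts of record of the T1 programme, cell pub/ns-inputs)

Definitions ONLY (plate (0′) of the N-W pieces; no theorem is claimed here).  The two declarations below
are VERBATIM the kit `pub/ns-inputs/kits/N4-T1-skeleton.lean` (ns-in-ser-b g2, sha16 118454bf17607d1e,
l.139–216), companions of the tree defs file `…Theorems.AxisTwistDoorAveragedConeLiouvilleNULipDefs`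
(p638908: `NUStandingLip` + the four atom texts `Sig.nuLip_*`), so that the N-W seats prove
`theorem nu_weakEnergyIdentity : Sig.nu_weakEnergyIdentity` (W1, ns-in-ser-b g2; bricks landed:
`nu_weakEnergy_timeWeighted` p638460, `nu_weakEnergy_slab` p639159, slab/Steklov/limit tools p638854
p639426) and `theorem … : Sig.nu_weakEnergyIdentity → Sig.nu_standing_of_weak` (W, ns-in-ser-c g2) BY NAME
against the same tree text (plan g6 ownership table, pub/ns-inputs/STATUS 2026-08-28T14:00:36Z);
`--supports stmt-NavierStokesRegularity-26889 --as helper`.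
* `Sig.nu_weakEnergyIdentity`: for the weak data of the typed fact
  `Literature.Analysis.FluidPDE.NazarovUraltseva2011_positivity_propagation` on `]0,T[ × B(0,1)`
  (Lipschitz `V ≥ 0`, measurable bounded `b`, the integral supersolution inequality against
  nonnegative Lipschitz tests; the divergence condition is NOT used), every `H ∈ C²`, `H′ ≤ 0`,
  `H ≥ 0`, `Θ ∈ C¹` supported in `B(0,ρ₀)`, `ρ₀ < 1`, `η ∈ C¹`, `η ≥ 0`, `0 < t₁ ≤ t₂ < T`:
  `η(t₂)M(t₂) + ∫∫ ηH″(V)|∇V|²Θ² ≤ η(t₁)M(t₁) − ∫∫ ηH′(V)⟪∇V,∇Θ²⟫ − ∫∫ ηΘ²H′(V)⟪b,∇V⟫ + ∫∫ |η′|H(V)Θ²`,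
  `M(t) = ∫ H(V(t,x))Θ(x)² dx`.
* `Sig.nu_standing_of_weak`: weak Lipschitz data ⇒ `NUStandingLip` frames (the analogue of the landed
  `Sig.nu_standing_of_classical` / `nu_standing_of_classical` p632808).

WHAT THIS IS NOT: no Navier–Stokes statement; these are targets of the re-proof of the INPUT
`NazarovUraltseva2011_positivity_propagation` (N4/T1); item 26889 and the summit stay open; nothing is
proved or closed by this file.

## References
* A. I. Nazarov, N. N. Ural'tseva, Algebra i Analiz 23:1 (2011) 136–168 = St. Petersburg Math. J.
  23 (2012) 93–115, arXiv:1011.1888, §1 pp. 2–3, §3 (3.2). [cite: NazarovUraltseva2011HarnackDivFree, §1 p. 2–3, §3 (3.2) (arXiv p. 8)]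
-/

noncomputable section

-- the summit and its single sub-problem share the name (CONVENTIONS §1)
set_option linter.dupNamespace false

open MeasureTheory Set Function Metric
open scoped NNReal ENNReal InnerProductSpace

namespace Summit.NavierStokesRegularity.NavierStokesRegularity.Theorems.AveragedConeLiouville.NUPositivity

/-! ### N-W: weak Lipschitz data ⇒ frames -/

/-- **W1 = `Sig.nu_weakEnergyIdentity` (N-W part 1): the energy inequality of a Lipschitz generalized
supersolution BEFORE the divergence-free transfer.** For the weak data of the typed fact on
`]0,T[ × B(0,1)` (Lipschitz `V ≥ 0`, measurable `b` — the bound and the divergence condition are NOT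
used here), every `H ∈ C²` with `H' ≤ 0`, every `Θ ∈ C¹` with `tsupport Θ ⊆ B(0,ρ₀)`, `ρ₀ < 1`, every
`η ∈ C¹`, `η ≥ 0`, and all `0 < t₁ ≤ t₂ < T`:
`η(t₂)M(t₂) + ∫∫ η H''(V)|∇V|²Θ² ≤ η(t₁)M(t₁) − ∫∫ η H'(V)⟪∇V,∇Θ²⟫ − ∫∫ η Θ² H'(V)⟪b,∇V⟫ + ∫∫ |η'| H(V)Θ²`
(slab `[t₁,t₂] × ℝ³`; `M(t) = ∫ H(V(t,x))Θ(x)² dx`; test `−H'(V)Θ²ηχ_h`, `χ_h` a Lipschitz time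
plateau, `h → 0`). -/
def Sig.nu_weakEnergyIdentity : Prop :=
    ∀ (T : ℝ) (V : ℝ → EuclideanSpace ℝ (Fin 3) → ℝ)
      (b : ℝ → EuclideanSpace ℝ (Fin 3) → EuclideanSpace ℝ (Fin 3)),
      Measurable (uncurry b) →
      (∃ Λ : ℝ, ∀ t ∈ Ioo 0 T, ∀ x ∈ ball (0 : EuclideanSpace ℝ (Fin 3)) 1, ‖b t x‖ ≤ Λ) →
      (∃ L, LipschitzOnWith L (uncurry V) (Ioo 0 T ×ˢ ball (0 : EuclideanSpace ℝ (Fin 3)) 1)) →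
      (∀ t ∈ Ioo 0 T, ∀ x ∈ ball (0 : EuclideanSpace ℝ (Fin 3)) 1, 0 ≤ V t x) →
      (∀ η : ℝ → EuclideanSpace ℝ (Fin 3) → ℝ, (∃ K, LipschitzWith K (uncurry η)) → (∀ t x, 0 ≤ η t x) →
        (∃ ρ τ : ℝ, ρ < 1 ∧ 0 < τ ∧ ∀ t x, (ρ ≤ ‖x‖ ∨ t ≤ τ) → η t x = 0) →
        0 ≤ ∫ p in Ioo 0 T ×ˢ ball (0 : EuclideanSpace ℝ (Fin 3)) 1,
          (deriv (fun s => V s p.2) p.1 * η p.1 p.2 +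
            inner ℝ (gradient (V p.1) p.2) (gradient (η p.1) p.2) +
            inner ℝ (b p.1 p.2) (gradient (V p.1) p.2) * η p.1 p.2)) →
    ∀ (H : ℝ → ℝ), ContDiff ℝ 2 H → (∀ v, deriv H v ≤ 0) → (∀ v, 0 ≤ H v) →
    ∀ (Θ : EuclideanSpace ℝ (Fin 3) → ℝ), ContDiff ℝ 1 Θ → HasCompactSupport Θ →
    ∀ (ρ₀ : ℝ), ρ₀ < 1 → tsupport Θ ⊆ ball (0 : EuclideanSpace ℝ (Fin 3)) ρ₀ →
    ∀ (η : ℝ → ℝ), ContDiff ℝ 1 η → (∀ s, 0 ≤ η s) →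
    ∀ (t₁ t₂ : ℝ), 0 < t₁ → t₁ ≤ t₂ → t₂ < T →
      η t₂ * (∫ x, H (V t₂ x) * Θ x ^ 2) +
        (∫ z in Icc t₁ t₂ ×ˢ (univ : Set (EuclideanSpace ℝ (Fin 3))),
          η z.1 * (deriv (deriv H) (V z.1 z.2) * ‖gradient (V z.1) z.2‖ ^ 2 * Θ z.2 ^ 2)) ≤
      η t₁ * (∫ x, H (V t₁ x) * Θ x ^ 2) -
        (∫ z in Icc t₁ t₂ ×ˢ (univ : Set (EuclideanSpace ℝ (Fin 3))),
          η z.1 * (deriv H (V z.1 z.2) * inner ℝ (gradient (V z.1) z.2) (gradient (fun y => Θ y ^ 2) z.2))) -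
        (∫ z in Icc t₁ t₂ ×ˢ (univ : Set (EuclideanSpace ℝ (Fin 3))),
          η z.1 * (Θ z.2 ^ 2 * (deriv H (V z.1 z.2) * inner ℝ (b z.1 z.2) (gradient (V z.1) z.2)))) +
        (∫ z in Icc t₁ t₂ ×ˢ (univ : Set (EuclideanSpace ℝ (Fin 3))),
          |deriv η z.1| * (H (V z.1 z.2) * Θ z.2 ^ 2))

/-- **W = `Sig.nu_standing_of_weak` (N-W): weak Lipschitz data ⇒ `NUStandingLip` frames** — the
exact analogue of the landed `Sig.nu_standing_of_classical` (p632808) with the hypotheses of the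
typed fact (data clauses VERBATIM from `Literature.Analysis.FluidPDE.NazarovUraltseva2011_positivity_propagation`). -/
def Sig.nu_standing_of_weak : Prop :=
    ∀ (Λ : ℝ), 0 ≤ Λ → ∃ N : ℝ≥0,
    ∀ (T : ℝ) (V : ℝ → EuclideanSpace ℝ (Fin 3) → ℝ)
      (b : ℝ → EuclideanSpace ℝ (Fin 3) → EuclideanSpace ℝ (Fin 3)),
      Measurable (uncurry b) →
      (∀ t ∈ Ioo 0 T, ∀ x ∈ ball (0 : EuclideanSpace ℝ (Fin 3)) 1, ‖b t x‖ ≤ Λ) →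
      (∀ φ : ℝ → EuclideanSpace ℝ (Fin 3) → ℝ, ContDiff ℝ (⊤ : ℕ∞) (uncurry φ) →
        HasCompactSupport (uncurry φ) →
        tsupport (uncurry φ) ⊆ Ioo 0 T ×ˢ ball (0 : EuclideanSpace ℝ (Fin 3)) 1 →
        ∫ p in Ioo 0 T ×ˢ ball (0 : EuclideanSpace ℝ (Fin 3)) 1,
          inner ℝ (b p.1 p.2) (gradient (φ p.1) p.2) = 0) →
      (∃ L, LipschitzOnWith L (uncurry V) (Ioo 0 T ×ˢ ball (0 : EuclideanSpace ℝ (Fin 3)) 1)) →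
      (∀ t ∈ Ioo 0 T, ∀ x ∈ ball (0 : EuclideanSpace ℝ (Fin 3)) 1, 0 ≤ V t x) →
      (∀ η : ℝ → EuclideanSpace ℝ (Fin 3) → ℝ, (∃ K, LipschitzWith K (uncurry η)) → (∀ t x, 0 ≤ η t x) →
        (∃ ρ τ : ℝ, ρ < 1 ∧ 0 < τ ∧ ∀ t x, (ρ ≤ ‖x‖ ∨ t ≤ τ) → η t x = 0) →
        0 ≤ ∫ p in Ioo 0 T ×ˢ ball (0 : EuclideanSpace ℝ (Fin 3)) 1,
          (deriv (fun s => V s p.2) p.1 * η p.1 p.2 +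
            inner ℝ (gradient (V p.1) p.2) (gradient (η p.1) p.2) +
            inner ℝ (b p.1 p.2) (gradient (V p.1) p.2) * η p.1 p.2)) →
    ∀ (k tstar τ R : ℝ), 0 < k → 0 < tstar → tstar < τ → τ ≤ T → 0 < R → 2 * R < 1 →
      ∃ (Φ : ℝ → EuclideanSpace ℝ (Fin 3) → ℝ)
        (U : ℝ → EuclideanSpace ℝ (Fin 3) → EuclideanSpace ℝ (Fin 3)),
        NUStandingLip Φ U k R N ∧
        ∀ t x, tstar ≤ t + τ → t < 0 → x ∈ ball (0 : EuclideanSpace ℝ (Fin 3)) (2 * R) →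
          Φ t x = V (t + τ) x

end Summit.NavierStokesRegularity.NavierStokesRegularity.Theorems.AveragedConeLiouville.NUPositivity

end
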